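import Mathlib.LinearAlgebra.Matrix.NonsingularInverse
import Mathlib.LinearAlgebra.Matrix.Rank
import Mathlib.LinearAlgebra.FiniteDimensional.Lemmas
import Mathlib.Order.ConditionallyCompleteLattice.Finset
import Mathlib.Algebra.BigOperators.Fin
import Literature.NumberTheory.Transcendental.BrumerPadicBaker
import HarnessLib

/-!
# Roy's dimension and rank theorems for linear forms in `p`-adic logarithms
# (Roy 1992, §4 Theorem 4 and Corollary 1, §5 Theorem 5, for `K ⊇ ℚ̄` a `p`-adic field)

Topic `Literature/NumberTheory/Transcendental` (namespace `Literature.NumberTheory.Transcendental`,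
grouping sub-namespace `RoyPadic` for the vocabulary). Ledger item `wi-18312` (consumer: route
Langlands/AlgebraicTraceRigidity, crux `TangentRigidity`, used with `d = 5`, `φ(4,5) = 20`).
Source: D. Roy, *Matrices whose coefficients are linear forms in logarithms*, J. Number Theory 41
(1992) 22–47 [`Roy1992`], read from the materialised text: Notations p. 24, §4 Theorem 4 (p. 34),
definition of `θ̃` (p. 37), Corollary 1 (p. 38), §5 definition of `φ` (pp. 38–39), Theorem 5
(p. 39), Lemma (p. 40), Theorem 6 (p. 41). The COMPLEX case (`K = ℂ`) of the same statements is
already in the tree, hard-wired to `ℂ`: `Literature.Barriers.Schanuel.roy1992_thm4`, `thetaBar`,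
`roy1992_cor1`, `roy1992_strongSixExponentials` (with Corollary 1 ⇒ Corollary 2 and Theorem 4 ⇒
Corollary 1 PROVED there); this file is the `p`-ADIC companion.

## The setting [Roy1992, Notations p. 24]

"We denote by `ℚ̄` an algebraic closure of `ℚ`, and by `K` the field `ℂ` (resp. `ℂ_p`) obtained by
taking the completion of `ℚ̄` with respect to its absolute value extending … the `p`-adic absolute
value of `ℚ` … the usual series of the logarithm defines a continuous mapping `log : 𝒰 → K` from the
open set `𝒰` of elements `x` of `K` satisfying `|x − 1| < 1` … We denote by `L` the `ℚ`-vector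
subspace of `K` generated by `log(ℚ̄ ∩ 𝒰)` … For each integer `d > 0`, we put on the `K`-vector
space `K^d` the `ℚ̄`-structure `ℚ̄^d`. This gives immediately the notions of a `K`-vector subspace of
`K^d` which is rational over `ℚ̄` and of a `K`-linear mapping `f : K^{d₁} → K^{d₂}` which is rational
over `ℚ̄`. Finally, we let `𝓛̃ = ℚ̄ + ℚ̄·L`."

**Choice of `K` here.** The tree's `p`-adic logarithm and the consumer route live on
`ℚ̄_p = PadicAlgCl p` (Mathlib's algebraic closure of `ℚ_p`, a normed field, NOT complete), with
`ℚ̄ = padicQbar p = algebraicClosure ℚ (PadicAlgCl p)` and Iwasawa's `log_p = padicLogAlgCl p`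
(`Transcendental/PadicLogAlgCl.lean`; on principal units it is the usual series,
`padicLogAlgCl_isIwasawaLog`, clause (i)). We state Roy's theorems for `K = ℚ̄_p`. This is a
FAITHFUL SPECIAL CASE of the printed `K = ℂ_p`: `L ⊆ 𝓛̃ ⊆ ℚ̄_p` (an algebraic principal unit lies in
a number field, so its logarithmic series converges in a finite, complete extension of `ℚ_p`), the
maps "rational over `ℚ̄`" `K^d → K^{d'}` are the same matrices with entries in `ℚ̄` for `K = ℚ̄_p` and
for `K = ℂ_p`, and for a `ℚ̄_p`-subspace `U ⊆ ℚ̄_p^d` the base change `ℂ_p·U` has the same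
dimension, the same images `dim ℂ_p·t(U) = dim t(U)`, the same intersections with `ℚ̄^d`, `𝓛̃^d`
and `ℚ̄_p^d`, and the same enveloping `ℚ̄`-rational subspaces; so each statement below is Roy's
statement restricted to `ℂ_p`-subspaces defined over `ℚ̄_p`.

## Contents

Definitions (with bodies), sub-namespace `RoyPadic`:
* `logQSpan p` — Roy's `L`: the `ℚ`-span of `{log_p u : u ∈ ℚ̄, |u − 1| < 1}`;
* `logLinearForms p` — Roy's `𝓛̃ = ℚ̄ + ℚ̄·L`: the `ℚ̄`-span of `{1} ∪ {log_p u : u ∈ ℚ̄ ∩ 𝒰}`;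
* `IsRationalMap t` — a `K`-linear `t : K^{d₁} → K^{d₂}` is rational over `ℚ̄` (`t(ℚ̄^{d₁}) ⊆ ℚ̄^{d₂}`);
  `IsRationalSubspace T` — a `K`-subspace of `K^d` generated over `K` by elements of `ℚ̄^d`;
* `IsBlockCouple M d' l'`, `blockCouples M`, `thetaBar M` — Roy's `θ̃(M)` (p. 37), verbatim port
  of the complex-case `Literature.Barriers.Schanuel.thetaBar`;
* `IsDecomposition`, `phi n d` — Roy's `φ(n, d)` (§5, pp. 38–39): the maximum of
  `Σᵢ nᵢdᵢ/(dᵢ − nᵢ)` over all decompositions `(n, d) = Σᵢ (nᵢ, dᵢ)` with `0 < nᵢ < dᵢ`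
  (real-valued supremum of a bounded set, non-empty for `0 < n < d`).

Named facts (D-0014; nothing asserted; +3, the three printed results the item requests):
* `roy1992_padic_thm4` — Theorem 4 (p. 34), verbatim in the shape of the tree's complex
  `roy1992_thm4`;
* `roy1992_padic_thm5` — Theorem 5 (p. 39): `U ⊆ K^d`, `U ∩ ℚ̄^d = 0`, `K^d` the smallest
  `ℚ̄`-rational subspace containing `U` ⟹ `0 < n = dim U < d` and `dim_ℚ̄(U ∩ 𝓛̃^d) ≤ φ(n, d)`
  (rendered: every finite-dimensional `ℚ̄`-subspace `Z ⊆ U ∩ 𝓛̃^d` has `dim Z ≤ φ(n,d)`, which is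
  the printed proof's own reduction, p. 39 l. 1 and p. 40 "the choice of `Z` being arbitrary");
* `roy1992_padic_cor1` — Corollary 1 (p. 38): `rank M ≥ θ̃(M)·d/(1 + θ̃(M))` for `d × l` matrices
  with entries in `𝓛̃`.

PROVED:
* the value used downstream, `phi n (n + 1) = n(n + 1)` (`phi_succ`: a decomposition of
  `(n, n+1)` has a single couple, since `dᵢ ≥ nᵢ + 1`), and `phi 1 d = d/(d − 1)`; the general bounds
  `nd/(d − n) ≤ φ(n,d) ≤ n²d` (`div_le_phi`, `phi_le`); these are the two closed cases of Roy's
  Lemma (p. 40), whose general recursion `φ(n,d) = φ(1, d−n) + φ(n−1, n)` is NOT vendored;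
* the `θ̃` API (`thetaBar_le`, `le_thetaBar`, attainment, nonnegativity), as in the complex file.

* **Corollary 2 for `ℚ̄_p`** (the `p`-adic strong six exponentials theorem: a `2 × 3` matrix with
  entries in `𝓛̃` and `ℚ̄`-independent rows and columns has rank `2`) PROVED from Corollary 1 along
  the printed proof (`roy1992_padic_strongSixExponentials_of_cor1`, via
  `thetaBar_eq_of_rank_le_one`), a port of the complex-case
  `Literature.Barriers.Schanuel.roy1992_strongSixExponentials_of_cor1`.

NOT here: Theorem 6 (p. 41: `φ` is sharp up to a factor `2`), Theorems 1–3 and 7, and the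
deductions Theorem 4 ⇒ Corollary 1 (proved for `ℂ` in
`AlgebraicIndependenceOfLogarithmsThm4Proofs.lean`; the same port would discharge
`roy1992_padic_cor1` modulo `roy1992_padic_thm4`) and Theorem 4 ⇒ Theorem 5 (pp. 39–40).

## References

* [Roy1992] D. Roy, J. Number Theory 41 (1992) 22–47: Notations (p. 24); §4 Theorem 4 (p. 34),
  Remarks and definition of `θ̃` (p. 37), Corollary 1, Corollary 2 (p. 38); §5 definition of `φ`
  (pp. 38–39), Theorem 5 (p. 39), Lemma (p. 40), Theorem 6 (p. 41).
* [LangCyclotomic1990] S. Lang, *Cyclotomic Fields I and II*, Ch. 4, Appendix to §3 (Iwasawa's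
  logarithm) — via `Transcendental/PadicLogAlgCl.lean`.
* [Brumer1967] A. Brumer, Mathematika 14 (1967), Theorem 1 — via `Transcendental/BrumerPadicBaker.lean`
  ("Baker's theorem" for `K = ℂ_p` in Roy's terminology, p. 24).
-/

noncomputable section

open Module

namespace Literature.NumberTheory.Transcendental

namespace RoyPadic

variable (p : ℕ) [Fact p.Prime]

/-! ### `L` and `𝓛̃` for `K = ℚ̄_p` -/

/-- Roy's `L` for the `p`-adic field: "the `ℚ`-vector subspace of `K` generated by `log(ℚ̄ ∩ 𝒰)`",
`𝒰 = {x : |x − 1| < 1}`, `log` the logarithmic series — here `log_p = padicLogAlgCl p` on the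
algebraic principal units of `ℚ̄_p` (where it is the usual series, `padicLogAlgCl_isIwasawaLog` (i)).
[cite: Roy1992, Notations (p. 24)] -/
def logQSpan : Submodule ℚ (PadicAlgCl p) :=
  Submodule.span ℚ {z | ∃ u : PadicAlgCl p, IsAlgebraic ℚ u ∧ ‖1 - u‖ < 1 ∧ z = padicLogAlgCl p u}

/-- Roy's `𝓛̃ = ℚ̄ + ℚ̄·L` for the `p`-adic field: the `ℚ̄`-span (`ℚ̄ = padicQbar p`) of `1` and of the
`p`-adic logarithms of the algebraic principal units — the LINEAR FORMS IN `p`-ADIC LOGARITHMS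
`β₀ + β₁ log_p u₁ + ⋯ + βₘ log_p uₘ` with algebraic `βⱼ` and algebraic `uᵢ`, `|uᵢ − 1| < 1`.
[cite: Roy1992, Notations (p. 24)] -/
def logLinearForms : Submodule (padicQbar p) (PadicAlgCl p) :=
  Submodule.span (padicQbar p)
    ({1} ∪ {z | ∃ u : PadicAlgCl p, IsAlgebraic ℚ u ∧ ‖1 - u‖ < 1 ∧ z = padicLogAlgCl p u})

/-- `1 ∈ 𝓛̃` (so `ℚ̄ ⊆ 𝓛̃`). [cite: Roy1992, Notations (p. 24)] -/
theorem one_mem_logLinearForms : (1 : PadicAlgCl p) ∈ logLinearForms p :=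
  Submodule.subset_span (Set.mem_union_left _ rfl)

/-- The logarithm of an algebraic principal unit lies in `𝓛̃`. [cite: Roy1992, Notations (p. 24)] -/
theorem log_mem_logLinearForms {u : PadicAlgCl p} (hu : IsAlgebraic ℚ u) (h1 : ‖1 - u‖ < 1) :
    padicLogAlgCl p u ∈ logLinearForms p :=
  Submodule.subset_span (Set.mem_union_right _ ⟨u, hu, h1, rfl⟩)

/-- `L ⊆ 𝓛̃` (`L` is a `ℚ`-space, `𝓛̃` a `ℚ̄`-space; compare after restricting scalars to `ℚ`).
[cite: Roy1992, Notations (p. 24)] -/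
theorem logQSpan_le : logQSpan p ≤ (logLinearForms p).restrictScalars ℚ := by
  refine Submodule.span_le.2 ?_
  rintro _ ⟨u, hu, h1, rfl⟩
  exact log_mem_logLinearForms p hu h1

/-! ### Rationality over `ℚ̄` [Roy1992, Notations p. 24] -/

variable {p}

/-- A `K`-linear map `t : K^{d₁} → K^{d₂}` (`K = ℚ̄_p`) is **rational over `ℚ̄`** if
`t(ℚ̄^{d₁}) ⊆ ℚ̄^{d₂}` (Bourbaki's notion for the `ℚ̄`-structures `ℚ̄^{dᵢ} ⊂ K^{dᵢ}`).
[cite: Roy1992, Notations (p. 24)] -/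
def IsRationalMap {d₁ d₂ : ℕ} (t : (Fin d₁ → PadicAlgCl p) →ₗ[PadicAlgCl p] (Fin d₂ → PadicAlgCl p)) :
    Prop :=
  ∀ v : Fin d₁ → PadicAlgCl p, (∀ i, v i ∈ padicQbar p) → ∀ j, t v j ∈ padicQbar p

/-- A `K`-subspace `T ⊆ K^d` is **rational over `ℚ̄`** if it is generated over `K` by elements of
`ℚ̄^d`, i.e. by its own `ℚ̄`-points. [cite: Roy1992, Notations (p. 24)] -/
def IsRationalSubspace {d : ℕ} (T : Submodule (PadicAlgCl p) (Fin d → PadicAlgCl p)) : Prop :=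
  Submodule.span (PadicAlgCl p) {v | v ∈ T ∧ ∀ i, v i ∈ padicQbar p} = T

/-- The identity map is rational over `ℚ̄`. [folklore] -/
theorem isRationalMap_id (d : ℕ) :
    IsRationalMap (p := p) (LinearMap.id : (Fin d → PadicAlgCl p) →ₗ[PadicAlgCl p] _) :=
  fun _ hv j => hv j

/-- `K^d` itself is rational over `ℚ̄` (it is spanned by the standard basis vectors, which have
coordinates `0, 1 ∈ ℚ̄`). [folklore] -/
theorem isRationalSubspace_top (d : ℕ) :
    IsRationalSubspace (p := p) (⊤ : Submodule (PadicAlgCl p) (Fin d → PadicAlgCl p)) := by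
  rw [IsRationalSubspace, eq_top_iff]
  have hstd : ∀ i : Fin d, (Pi.single i (1 : PadicAlgCl p) : Fin d → PadicAlgCl p) ∈
      Submodule.span (PadicAlgCl p)
        {v : Fin d → PadicAlgCl p | v ∈ (⊤ : Submodule (PadicAlgCl p) _) ∧ ∀ i, v i ∈ padicQbar p} := by
    intro i
    refine Submodule.subset_span ⟨Submodule.mem_top, fun j => ?_⟩
    by_cases h : j = i
    · subst h; simp
    · simp [h]
  intro v _
  rw [← Finset.univ_sum_single v]
  refine Submodule.sum_mem _ fun i _ => ?_
  have : Pi.single i (v i) = v i • (Pi.single i (1 : PadicAlgCl p) : Fin d → PadicAlgCl p) := by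
    rw [← Pi.single_smul', smul_eq_mul, mul_one]
  rw [this]
  exact Submodule.smul_mem _ _ (hstd i)

/-! ### Roy's invariant `θ̃(M)` [Roy1992, §4 p. 37] -/

section Theta

variable {d l : ℕ}

/-- **Admissible couples for `θ̃(M)`.** For a `d × l` matrix `M` over `K = ℚ̄_p`, the couple
`(d', l')` is admissible if `0 < d' ≤ d`, `0 ≤ l' ≤ l` and there are `P ∈ GL_d(ℚ̄)`, `Q ∈ GL_l(ℚ̄)`
with `PMQ = (M' 0; N N')`, `M'` of size `d' × l'` (the entries of `PMQ` in the first `d'` rows and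
the last `l − l'` columns vanish). Port of the complex-case `Literature.Barriers.Schanuel.IsBlockCouple`.
[cite: Roy1992, §4 (definition of θ̃, p. 37)] -/
def IsBlockCouple (M : Matrix (Fin d) (Fin l) (PadicAlgCl p)) (d' l' : ℕ) : Prop :=
  0 < d' ∧ d' ≤ d ∧ l' ≤ l ∧
    ∃ (P : Matrix (Fin d) (Fin d) (padicQbar p)) (Q : Matrix (Fin l) (Fin l) (padicQbar p)),
      IsUnit P ∧ IsUnit Q ∧
      ∀ (i : Fin d) (j : Fin l), (i : ℕ) < d' → l' ≤ (j : ℕ) →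
        (P.map (algebraMap (padicQbar p) (PadicAlgCl p)) * M *
          Q.map (algebraMap (padicQbar p) (PadicAlgCl p))) i j = 0

/-- The set of admissible couples `(d', l')` of `M`. [cite: Roy1992, §4 (definition of θ̃, p. 37)] -/
def blockCouples (M : Matrix (Fin d) (Fin l) (PadicAlgCl p)) : Set (ℕ × ℕ) :=
  {c | IsBlockCouple M c.1 c.2}

/-- **Roy's `θ̃(M)`** for a matrix over `K = ℚ̄_p`: "the minimum of all ratios `l'/d'`, when `(d', l')`
runs among the couples of integers satisfying `0 < d' ≤ d` and `0 ≤ l' ≤ l`, for which there exist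
matrices `P ∈ GL_d(ℚ̄)` and `Q ∈ GL_l(ℚ̄)` such that the product `PMQ` can be written `(M' 0; N N')`
with `M'` of size `d' × l'`" (real-valued infimum over a finite set, a minimum when `d > 0`; junk
`sInf ∅` for `d = 0`). [cite: Roy1992, §4 (definition of θ̃, p. 37)] -/
def thetaBar (M : Matrix (Fin d) (Fin l) (PadicAlgCl p)) : ℝ :=
  sInf ((fun c : ℕ × ℕ => (c.2 : ℝ) / (c.1 : ℝ)) '' blockCouples M)

/-- `(d, l)` is admissible when `d > 0` (`P = Q = 1`). [cite: Roy1992, §4 (definition of θ̃, p. 37)] -/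
theorem isBlockCouple_self (M : Matrix (Fin d) (Fin l) (PadicAlgCl p)) (hd : 0 < d) :
    IsBlockCouple M d l := by
  refine ⟨hd, le_rfl, le_rfl, 1, 1, isUnit_one, isUnit_one, ?_⟩
  intro i j _ hj
  exact absurd hj (not_le.2 j.isLt)

/-- The admissible couples form a finite set. [folklore] -/
theorem blockCouples_finite (M : Matrix (Fin d) (Fin l) (PadicAlgCl p)) : (blockCouples M).Finite := by
  refine Set.Finite.subset (Finset.finite_toSet (Finset.range (d + 1) ×ˢ Finset.range (l + 1))) ?_
  rintro ⟨d', l'⟩ ⟨_, hd', hl', -⟩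
  simp only [Finset.coe_product, Finset.coe_range, Set.mem_prod, Set.mem_Iio]
  omega

/-- `θ̃(M) ≤ l'/d'` for every admissible couple. [cite: Roy1992, §4 (definition of θ̃, p. 37)] -/
theorem thetaBar_le_div {M : Matrix (Fin d) (Fin l) (PadicAlgCl p)} {d' l' : ℕ}
    (h : IsBlockCouple M d' l') : thetaBar M ≤ (l' : ℝ) / (d' : ℝ) :=
  csInf_le ((blockCouples_finite M).image _).bddBelow ⟨(d', l'), h, rfl⟩

/-- `θ̃(M) ≤ l/d` (`d > 0`). [cite: Roy1992, §4 (definition of θ̃, p. 37)] -/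
theorem thetaBar_le (M : Matrix (Fin d) (Fin l) (PadicAlgCl p)) (hd : 0 < d) :
    thetaBar M ≤ (l : ℝ) / (d : ℝ) :=
  thetaBar_le_div (isBlockCouple_self M hd)

/-- The minimum defining `θ̃(M)` is attained (`d > 0`). [cite: Roy1992, §4 (definition of θ̃, p. 37)] -/
theorem exists_isBlockCouple_thetaBar_eq (M : Matrix (Fin d) (Fin l) (PadicAlgCl p)) (hd : 0 < d) :
    ∃ d' l' : ℕ, IsBlockCouple M d' l' ∧ thetaBar M = (l' : ℝ) / (d' : ℝ) := by
  have hne : ((fun c : ℕ × ℕ => (c.2 : ℝ) / (c.1 : ℝ)) '' blockCouples M).Nonempty :=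
    ⟨_, (d, l), isBlockCouple_self M hd, rfl⟩
  obtain ⟨⟨d', l'⟩, hc, heq⟩ := hne.csInf_mem ((blockCouples_finite M).image _)
  exact ⟨d', l', hc, heq.symm⟩

/-- A lower bound valid for all admissible ratios bounds `θ̃(M)` from below (`d > 0`).
[cite: Roy1992, §4 (definition of θ̃, p. 37)] -/
theorem le_thetaBar {M : Matrix (Fin d) (Fin l) (PadicAlgCl p)} (hd : 0 < d) {x : ℝ}
    (h : ∀ d' l' : ℕ, IsBlockCouple M d' l' → x ≤ (l' : ℝ) / (d' : ℝ)) : x ≤ thetaBar M := by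
  obtain ⟨d', l', hc, heq⟩ := exists_isBlockCouple_thetaBar_eq M hd
  rw [heq]
  exact h d' l' hc

/-- `0 ≤ θ̃(M)` (`d > 0`). [folklore] -/
theorem thetaBar_nonneg (M : Matrix (Fin d) (Fin l) (PadicAlgCl p)) (hd : 0 < d) : 0 ≤ thetaBar M :=
  le_thetaBar hd fun _ _ _ => by positivity

end Theta

/-! ### Roy's function `φ(n, d)` [Roy1992, §5 pp. 38–40] -/

section Phi

/-- A **decomposition** of the couple `(n, d)`: `k` couples `(nᵢ, dᵢ)` of natural numbers with
`0 < nᵢ < dᵢ`, `Σ nᵢ = n`, `Σ dᵢ = d` (repetitions allowed, order immaterial for the attached sum).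
[cite: Roy1992, §5 (definition of φ, pp. 38–39)] -/
def IsDecomposition (n d k : ℕ) (ns ds : Fin k → ℕ) : Prop :=
  (∀ i, 0 < ns i ∧ ns i < ds i) ∧ ∑ i, ns i = n ∧ ∑ i, ds i = d

/-- The sum `Σᵢ nᵢdᵢ/(dᵢ − nᵢ)` attached to a decomposition. [cite: Roy1992, §5 (definition of φ, pp. 38–39) and Lemma (p. 40)] -/
def decompSum (k : ℕ) (ns ds : Fin k → ℕ) : ℝ :=
  ∑ i, (ns i : ℝ) * (ds i : ℝ) / ((ds i : ℝ) - (ns i : ℝ))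

/-- The set of the sums attached to the decompositions of `(n, d)`. [cite: Roy1992, §5 (definition of φ, pp. 38–39)] -/
def decompSums (n d : ℕ) : Set ℝ :=
  {x | ∃ (k : ℕ) (ns ds : Fin k → ℕ), IsDecomposition n d k ns ds ∧ x = decompSum k ns ds}

/-- **Roy's `φ(n, d)`** (`0 < n < d`): "the maximum of all sums `Σᵢ nᵢdᵢ/(dᵢ − nᵢ)` corresponding
to all possible decompositions of `(n, d)` as a sum of couples of integers `(n₁, d₁), …, (n_k, d_k)`
satisfying `0 < nᵢ < dᵢ`" (the summand `nᵢdᵢ/(dᵢ − nᵢ) = nᵢ + nᵢ²/(dᵢ − nᵢ)` is read off the proof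
of the Lemma, p. 40; real-valued supremum of a bounded set, non-empty and attained for `0 < n < d`;
junk `sSup ∅` otherwise). By Roy's Lemma (p. 40) `φ(n,d) = nd/(d−n)` if `n = 1` or `d − n = 1`
(proved below: `phi_one`, `phi_succ`), and `φ(n,d) = φ(1, d−n) + φ(n−1, n)` otherwise (not
vendored). [cite: Roy1992, §5 (definition of φ, pp. 38–39)] -/
def phi (n d : ℕ) : ℝ :=
  sSup (decompSums n d)

/-- The one-couple decomposition `(n, d)` of `(n, d)` (`0 < n < d`). [folklore] -/
theorem isDecomposition_single {n d : ℕ} (hn : 0 < n) (hnd : n < d) :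
    IsDecomposition n d 1 (fun _ => n) (fun _ => d) :=
  ⟨fun _ => ⟨hn, hnd⟩, by simp, by simp⟩

/-- Its sum is `nd/(d − n)`. [folklore] -/
theorem decompSum_single (n d : ℕ) : decompSum 1 (fun _ => n) (fun _ => d) = (n : ℝ) * d / (d - n) := by
  simp [decompSum]

/-- Every attached sum is at most `n² d` (each summand `nᵢdᵢ/(dᵢ − nᵢ) ≤ nᵢdᵢ ≤ nᵢ·d`, and
`Σ nᵢ = n`; a crude bound making `φ` a genuine maximum). [folklore] -/
theorem decompSum_le {n d k : ℕ} {ns ds : Fin k → ℕ} (h : IsDecomposition n d k ns ds) :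
    decompSum k ns ds ≤ (n : ℝ) ^ 2 * d := by
  obtain ⟨hlt, hns, hds⟩ := h
  have hterm : ∀ i, (ns i : ℝ) * (ds i : ℝ) / ((ds i : ℝ) - (ns i : ℝ)) ≤ (ns i : ℝ) * d := by
    intro i
    obtain ⟨h0, h1⟩ := hlt i
    have hgap : (1 : ℝ) ≤ (ds i : ℝ) - (ns i : ℝ) := by
      have : ns i + 1 ≤ ds i := h1
      have := (Nat.cast_le (α := ℝ)).2 this
      push_cast at this
      linarith
    have hdi : (ds i : ℝ) ≤ d := by
      have : ds i ≤ ∑ j, ds j := Finset.single_le_sum (fun j _ => Nat.zero_le (ds j)) (Finset.mem_univ i)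
      rw [hds] at this
      exact_mod_cast this
    rw [div_le_iff₀ (by linarith)]
    have hn0 : (0 : ℝ) ≤ ns i := Nat.cast_nonneg _
    have h2 : (ns i : ℝ) * (ds i) ≤ (ns i) * d := mul_le_mul_of_nonneg_left hdi hn0
    have h3 : (ns i : ℝ) * d ≤ (ns i) * d * ((ds i : ℝ) - ns i) :=
      le_mul_of_one_le_right (mul_nonneg hn0 (Nat.cast_nonneg _)) hgap
    linarith
  calc decompSum k ns ds ≤ ∑ i, (ns i : ℝ) * d := Finset.sum_le_sum fun i _ => hterm i
    _ = (n : ℝ) * d := by rw [← Finset.sum_mul, ← Nat.cast_sum, hns]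
    _ ≤ (n : ℝ) ^ 2 * d := by
      have hn1 : (n : ℝ) ≤ (n : ℝ) ^ 2 := by
        rcases Nat.eq_zero_or_pos n with rfl | hn
        · simp
        · have : (1 : ℝ) ≤ n := by exact_mod_cast hn
          nlinarith
      exact mul_le_mul_of_nonneg_right hn1 (Nat.cast_nonneg _)

/-- The set of attached sums is bounded above. [folklore] -/
theorem bddAbove_decompSums (n d : ℕ) : BddAbove (decompSums n d) := by
  refine ⟨(n : ℝ) ^ 2 * d, ?_⟩
  rintro x ⟨k, ns, ds, h, rfl⟩
  exact decompSum_le h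

/-- Every attached sum is at most `φ(n, d)`. [cite: Roy1992, §5 (definition of φ, pp. 38–39)] -/
theorem decompSum_le_phi {n d k : ℕ} {ns ds : Fin k → ℕ} (h : IsDecomposition n d k ns ds) :
    decompSum k ns ds ≤ phi n d :=
  le_csSup (bddAbove_decompSums n d) ⟨k, ns, ds, h, rfl⟩

/-- `nd/(d − n) ≤ φ(n, d)` for `0 < n < d` (the one-couple decomposition). [cite: Roy1992, §5 Lemma (p. 40)] -/
theorem div_le_phi {n d : ℕ} (hn : 0 < n) (hnd : n < d) : (n : ℝ) * d / (d - n) ≤ phi n d := by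
  rw [← decompSum_single]
  exact decompSum_le_phi (isDecomposition_single hn hnd)

/-- An upper bound valid for all attached sums bounds `φ(n, d)` (`0 < n < d`). [folklore] -/
theorem phi_le {n d : ℕ} (hn : 0 < n) (hnd : n < d) {x : ℝ}
    (h : ∀ (k : ℕ) (ns ds : Fin k → ℕ), IsDecomposition n d k ns ds → decompSum k ns ds ≤ x) :
    phi n d ≤ x :=
  csSup_le ⟨_, 1, _, _, isDecomposition_single hn hnd, rfl⟩ (by rintro _ ⟨k, ns, ds, hd, rfl⟩; exact h k ns ds hd)

/-- `φ(n, d) ≤ n² d`. [folklore] -/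
theorem phi_le_sq_mul {n d : ℕ} (hn : 0 < n) (hnd : n < d) : phi n d ≤ (n : ℝ) ^ 2 * d :=
  phi_le hn hnd fun _ _ _ h => decompSum_le h

/-- In a decomposition, `k ≤ d − n` (each couple has `dᵢ − nᵢ ≥ 1`) and `k ≤ n` (each `nᵢ ≥ 1`).
[folklore] -/
theorem IsDecomposition.card_le {n d k : ℕ} {ns ds : Fin k → ℕ} (h : IsDecomposition n d k ns ds) :
    k + n ≤ d ∧ k ≤ n := by
  obtain ⟨hlt, hns, hds⟩ := h
  constructor
  · have : ∑ i : Fin k, (ns i + 1) ≤ ∑ i : Fin k, ds i :=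
      Finset.sum_le_sum fun i _ => (hlt i).2
    rw [Finset.sum_add_distrib, hns, hds] at this
    simpa [add_comm] using this
  · have : ∑ _i : Fin k, 1 ≤ ∑ i : Fin k, ns i := Finset.sum_le_sum fun i _ => (hlt i).1
    rw [hns] at this
    simpa using this

/-- A decomposition of `(n, d)` with `n > 0` has at least one couple. [folklore] -/
theorem IsDecomposition.pos {n d k : ℕ} {ns ds : Fin k → ℕ} (h : IsDecomposition n d k ns ds)
    (hn : 0 < n) : 0 < k := by
  obtain ⟨-, hns, -⟩ := h
  by_contra hk
  have hk0 : k = 0 := by omega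
  subst hk0
  simp at hns
  omega

/-- A decomposition with `k = 1` is the couple `(n, d)` itself. [folklore] -/
theorem IsDecomposition.eq_of_one {n d : ℕ} {ns ds : Fin 1 → ℕ} (h : IsDecomposition n d 1 ns ds) :
    ns 0 = n ∧ ds 0 = d := by
  obtain ⟨-, hns, hds⟩ := h
  simp only [Fin.sum_univ_one] at hns hds
  exact ⟨hns, hds⟩

/-- **`φ(n, n + 1) = n(n + 1)`** (Roy's Lemma, p. 40, case `d − n = 1`; the value `φ(4, 5) = 20`
used by the consumer route): a decomposition of `(n, n+1)` consists of a single couple.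
[cite: Roy1992, §5 Lemma (p. 40)] -/
theorem phi_succ {n : ℕ} (hn : 0 < n) : phi n (n + 1) = (n : ℝ) * (n + 1) := by
  apply le_antisymm
  · refine phi_le hn (Nat.lt_succ_self n) fun k ns ds h => ?_
    obtain ⟨h1, h2⟩ := h.card_le
    have hk1 := h.pos hn
    have hk : k = 1 := by omega
    subst hk
    obtain ⟨hns, hds⟩ := h.eq_of_one
    simp only [decompSum, Fin.sum_univ_one, hns, hds]
    push_cast
    rw [show ((n : ℝ) + 1 - n) = 1 by ring, div_one]
  · have := div_le_phi hn (Nat.lt_succ_self n)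
    push_cast at this
    rwa [show ((n : ℝ) + 1 - n) = 1 by ring, div_one] at this

/-- **`φ(1, d) = d/(d − 1)`** (Roy's Lemma, p. 40, case `n = 1`): a decomposition of `(1, d)` consists
of a single couple. [cite: Roy1992, §5 Lemma (p. 40)] -/
theorem phi_one {d : ℕ} (hd : 1 < d) : phi 1 d = (d : ℝ) / (d - 1) := by
  apply le_antisymm
  · refine phi_le Nat.one_pos hd fun k ns ds h => ?_
    obtain ⟨h1, h2⟩ := h.card_le
    have hk1 := h.pos Nat.one_pos
    have hk : k = 1 := by omega
    subst hk
    obtain ⟨hns, hds⟩ := h.eq_of_one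
    simp only [decompSum, Fin.sum_univ_one, hns, hds]
    push_cast
    rw [one_mul]
  · have := div_le_phi Nat.one_pos hd
    push_cast at this
    rwa [one_mul] at this

end Phi

end RoyPadic

/-! ### The named facts (Roy 1992, Theorem 4, Theorem 5, Corollary 1, for `K = ℚ̄_p`) -/

section Facts

open RoyPadic

variable (p : ℕ) [Fact p.Prime]

/-- **Roy 1992, §4 Theorem 4 (the main result), `p`-adic case — NAMED FACT.** "Let `d` be a positive
integer, `Z` be a finite dimensional `ℚ̄`-vector subspace of `𝓛̃^d`, and `U` be a `K`-vector subspace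
of `K^d` containing `Z`. Among the set of all surjective `K`-linear mappings `t : K^d → K^{d'}` which
are rational over `ℚ̄` and non-zero, we choose one for which the ratio `dim_K(t(U))/d'` is minimal.
Then, letting `Z' = t(Z)` and `U' = t(U)`, we have
`dim_ℚ̄(Z')/(d' + dim_ℚ̄(Z')) ≤ dim_K(U')/d' ≤ dim_K(U)/d`." Here `K = ℚ̄_p = PadicAlgCl p` (the
printed `K` is `ℂ_p`; this is the restriction to `ℂ_p`-subspaces defined over `ℚ̄_p`, see the file
header), `ℚ̄ = padicQbar p`, `𝓛̃ = RoyPadic.logLinearForms p` (linear forms in Iwasawa `p`-adic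
logarithms of algebraic principal units), "rational over `ℚ̄`" = `RoyPadic.IsRationalMap`, and the
conclusion is asserted for every minimising `t`, exactly in the shape of the tree's complex-case
`Literature.Barriers.Schanuel.roy1992_thm4`. Proved in print from Theorem 2, itself from
M. Waldschmidt's Theorem 1 ("Theorem 4.1 of [W3]", valid over `ℂ_p`). Users take
`(h : roy1992_padic_thm4 p)`. [cite: Roy1992, §4 Theorem 4 (p. 34) with Notations (p. 24)] -/
def roy1992_padic_thm4 : Prop :=
  ∀ (d : ℕ), 0 < d →
  ∀ (Z : Submodule (padicQbar p) (Fin d → PadicAlgCl p))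
    (U : Submodule (PadicAlgCl p) (Fin d → PadicAlgCl p)),
    Module.Finite (padicQbar p) Z →
    (∀ z ∈ Z, ∀ i, z i ∈ logLinearForms p) →
    Z ≤ U.restrictScalars (padicQbar p) →
  ∀ (d' : ℕ) (t : (Fin d → PadicAlgCl p) →ₗ[PadicAlgCl p] (Fin d' → PadicAlgCl p)),
    Function.Surjective t → IsRationalMap t → t ≠ 0 →
    (∀ (d'' : ℕ) (t' : (Fin d → PadicAlgCl p) →ₗ[PadicAlgCl p] (Fin d'' → PadicAlgCl p)),
        Function.Surjective t' → IsRationalMap t' → t' ≠ 0 →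
        (finrank (PadicAlgCl p) (U.map t) : ℝ) / d' ≤ (finrank (PadicAlgCl p) (U.map t') : ℝ) / d'') →
    (finrank (padicQbar p) (Z.map (t.restrictScalars (padicQbar p))) : ℝ) /
        (d' + finrank (padicQbar p) (Z.map (t.restrictScalars (padicQbar p)))) ≤
      (finrank (PadicAlgCl p) (U.map t) : ℝ) / d' ∧
    (finrank (PadicAlgCl p) (U.map t) : ℝ) / d' ≤ (finrank (PadicAlgCl p) U : ℝ) / d

/-- **Roy 1992, §5 Theorem 5 (dimension of `U ∩ 𝓛̃^d`), `p`-adic case — NAMED FACT.** "Let `d` be a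
positive integer, and let `U` be a `K`-vector subspace of `K^d` such that `U ∩ ℚ̄^d = 0`. Suppose that
`K^d` is the smallest subspace of `K^d` which is rational over `ℚ̄` and which contains `U`. Then, the
dimension of `U` is an integer `n` satisfying `0 < n < d`, and we have `dim_ℚ̄(U ∩ 𝓛̃^d) ≤ φ(n, d)`."
Here `K = ℚ̄_p = PadicAlgCl p` (printed: `ℂ_p`; restriction to subspaces defined over `ℚ̄_p`, see the
file header), `ℚ̄ = padicQbar p`, `𝓛̃ = RoyPadic.logLinearForms p`, `φ = RoyPadic.phi`, "rational
over `ℚ̄`" = `RoyPadic.IsRationalSubspace`; the dimension bound is rendered as: every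
finite-dimensional `ℚ̄`-subspace `Z` of `U` with coordinates in `𝓛̃` has `dim_ℚ̄ Z ≤ φ(n, d)` (the
printed proof's reduction: "Let `Z` be a `ℚ̄`-vector subspace of `U ∩ 𝓛̃^d` of finite dimension `l` …
the inequality `l ≤ φ(n, d)` being true in all cases, and the choice of `Z` being arbitrary, this
proves the theorem", pp. 39–40). Proved in print from Theorem 4 by induction on `d`. With
`φ(n, n+1) = n(n+1)` (`RoyPadic.phi_succ`) this gives `dim_ℚ̄(U ∩ 𝓛̃⁵) ≤ 20` for `n = 4`, `d = 5`.
Users take `(h : roy1992_padic_thm5 p)`. [cite: Roy1992, §5 Theorem 5 (p. 39) with the definition of φ (pp. 38–39)] -/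
def roy1992_padic_thm5 : Prop :=
  ∀ (d : ℕ), 0 < d →
  ∀ (U : Submodule (PadicAlgCl p) (Fin d → PadicAlgCl p)),
    (∀ u ∈ U, (∀ i, u i ∈ padicQbar p) → u = 0) →
    (∀ T : Submodule (PadicAlgCl p) (Fin d → PadicAlgCl p), IsRationalSubspace T → U ≤ T → T = ⊤) →
    0 < finrank (PadicAlgCl p) U ∧ finrank (PadicAlgCl p) U < d ∧
    ∀ (Z : Submodule (padicQbar p) (Fin d → PadicAlgCl p)), Module.Finite (padicQbar p) Z →
      Z ≤ U.restrictScalars (padicQbar p) → (∀ z ∈ Z, ∀ i, z i ∈ logLinearForms p) →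
      (finrank (padicQbar p) Z : ℝ) ≤ phi (finrank (PadicAlgCl p) U) d

/-- **Roy 1992, §4 Corollary 1 (lower bound for the rank of matrices of linear forms in
logarithms), `p`-adic case — NAMED FACT.** "Let `M` be a matrix with coefficients in `𝓛̃`, of size
`d × l` with `d, l > 0`, and let `n` be its rank. We have `n ≥ θ̃(M)·d/(1 + θ̃(M))`." Here
`K = ℚ̄_p = PadicAlgCl p` (printed: `ℂ_p`; the rank of a matrix with entries in `𝓛̃ ⊆ ℚ̄_p` is the
same over `ℚ̄_p` and over `ℂ_p`), `𝓛̃ = RoyPadic.logLinearForms p`, `θ̃ = RoyPadic.thetaBar`, in the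
shape of the tree's complex-case `Literature.Barriers.Schanuel.roy1992_cor1`. Deduced in print from
Theorem 4 (for `ℂ` this deduction is PROVED in
`AlgebraicIndependenceOfLogarithmsThm4Proofs.lean`; the same port would discharge this fact modulo
`roy1992_padic_thm4`). Users take `(h : roy1992_padic_cor1 p)`.
[cite: Roy1992, §4 Corollary 1 (p. 38) with the definition of θ̃ (p. 37)] -/
def roy1992_padic_cor1 : Prop :=
  ∀ (d l : ℕ) (M : Matrix (Fin d) (Fin l) (PadicAlgCl p)), 0 < d → 0 < l →
    (∀ i j, M i j ∈ logLinearForms p) →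
    thetaBar M * d / (1 + thetaBar M) ≤ (M.rank : ℝ)

/-- **The consumer's instance of Theorem 5** (`d = 5`, `n = 4`): from the fact, a `4`-dimensional
`K`-subspace `U ⊆ K⁵` with `U ∩ ℚ̄⁵ = 0`, not contained in any proper `ℚ̄`-rational subspace,
contains at most `20` `ℚ̄`-linearly independent points of `𝓛̃⁵` (`φ(4,5) = 20`, `RoyPadic.phi_succ`).
[cite: Roy1992, §5 Theorem 5 (p. 39) and Lemma (p. 40)] -/
theorem roy1992_padic_thm5.finrank_le_twenty (h : roy1992_padic_thm5 p)
    (U : Submodule (PadicAlgCl p) (Fin 5 → PadicAlgCl p)) (hU : finrank (PadicAlgCl p) U = 4)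
    (h0 : ∀ u ∈ U, (∀ i, u i ∈ padicQbar p) → u = 0)
    (henv : ∀ T : Submodule (PadicAlgCl p) (Fin 5 → PadicAlgCl p),
      IsRationalSubspace T → U ≤ T → T = ⊤)
    (Z : Submodule (padicQbar p) (Fin 5 → PadicAlgCl p)) [Module.Finite (padicQbar p) Z]
    (hZU : Z ≤ U.restrictScalars (padicQbar p)) (hZ : ∀ z ∈ Z, ∀ i, z i ∈ logLinearForms p) :
    finrank (padicQbar p) Z ≤ 20 := by
  have H := (h 5 (by norm_num) U h0 henv).2.2 Z inferInstance hZU hZ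
  rw [hU, phi_succ (by norm_num)] at H
  norm_num at H
  exact_mod_cast H

end Facts

/-! ### Corollary 2 for `ℚ̄_p` (strong six exponentials, `p`-adic) PROVED from Corollary 1 -/

section CorTwo

open RoyPadic

variable {p : ℕ} [Fact p.Prime] {d l : ℕ}

/-- In a matrix of rank `≤ 1` over a field, a zero entry lies on a zero row or on a zero column
(otherwise the `2 × 2` minor through it is a non-zero minor of size `2`). [folklore] -/
theorem row_or_col_eq_zero_of_rank_le_one {K : Type*} [Field K] {m n : ℕ}
    (N : Matrix (Fin m) (Fin n) K) (hN : N.rank ≤ 1) (i₀ : Fin m) (j₀ : Fin n) (h0 : N i₀ j₀ = 0) :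
    (∀ j, N i₀ j = 0) ∨ (∀ i, N i j₀ = 0) := by
  by_contra hcon
  push Not at hcon
  obtain ⟨⟨j, hj⟩, ⟨i, hi⟩⟩ := hcon
  -- the `2 × 2` minor on rows `i₀, i` and columns `j, j₀` vanishes since `rank N ≤ 1`
  have hdet : (N.submatrix ![i₀, i] ![j, j₀]).det = 0 := by
    by_contra hne
    have hU : IsUnit (N.submatrix ![i₀, i] ![j, j₀]) :=
      (Matrix.isUnit_iff_isUnit_det _).2 (isUnit_iff_ne_zero.2 hne)
    have h1 : (N.submatrix ![i₀, i] ![j, j₀]).rank = 2 := by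
      rw [Matrix.rank_of_isUnit _ hU, Fintype.card_fin]
    have h2 : (N.submatrix ![i₀, i] ![j, j₀]).rank ≤ N.rank := Matrix.rank_submatrix_le N _ _
    omega
  rw [Matrix.det_fin_two] at hdet
  simp only [Matrix.submatrix_apply, Matrix.cons_val_zero, Matrix.cons_val_one,
    Matrix.cons_val_fin_one, h0, zero_mul, sub_zero] at hdet
  rcases mul_eq_zero.1 hdet with h | h
  · exact hj h
  · exact hi h

/-- An invertible matrix over `ℚ̄` stays invertible in `ℚ̄_p`. [folklore] -/
theorem isUnit_map_padicQbar {n : ℕ} {P : Matrix (Fin n) (Fin n) (padicQbar p)} (hP : IsUnit P) :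
    IsUnit (P.map (algebraMap (padicQbar p) (PadicAlgCl p))) :=
  hP.map (algebraMap (padicQbar p) (PadicAlgCl p)).mapMatrix

/-- **The printed observation behind Corollary 2** (`p`-adic port of the complex-case
`Literature.Barriers.Schanuel.le_thetaBar_of_rank_le_one`): "for each matrix `M` of size `d × l` with
`d, l > 0`, of rank `1`, whose rows and columns are linearly independent over `ℚ̄`, we have
`θ̃(M) = l/d`" — proved as `l/d ≤ θ̃(M)` for rank `≤ 1`: an admissible couple with `l' < l` puts a
zero of the rank-`≤ 1` matrix `PMQ` at `(0, l')`, whence a zero row of `PM` or a zero column of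
`MQ`, i.e. a non-trivial `ℚ̄`-relation among the rows or the columns of `M`.
[cite: Roy1992, §4 proof of Corollary 2 (p. 38)] -/
theorem le_thetaBar_of_rank_le_one (M : Matrix (Fin d) (Fin l) (PadicAlgCl p)) (hd : 0 < d)
    (hrank : M.rank ≤ 1)
    (hrows : LinearIndependent (padicQbar p) (fun i => M i))
    (hcols : LinearIndependent (padicQbar p) (fun j => M.transpose j)) :
    (l : ℝ) / (d : ℝ) ≤ thetaBar M := by
  refine le_thetaBar hd fun d' l' hc => ?_
  obtain ⟨hd'0, hd'd, hl'l, P, Q, hP, hQ, hblock⟩ := hc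
  -- it suffices that `l' = l`
  suffices hl : l' = l by
    subst hl
    have hd0 : (0 : ℝ) < d := by exact_mod_cast hd
    have hd'0' : (0 : ℝ) < d' := by exact_mod_cast hd'0
    have hdd : (d' : ℝ) ≤ d := by exact_mod_cast hd'd
    rw [div_le_div_iff₀ hd0 hd'0']
    have hl0 : (0 : ℝ) ≤ l' := by positivity
    nlinarith
  by_contra hne
  have hlt : l' < l := lt_of_le_of_ne hl'l hne
  set P' : Matrix (Fin d) (Fin d) (PadicAlgCl p) := P.map (algebraMap (padicQbar p) (PadicAlgCl p))
    with hP'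
  set Q' : Matrix (Fin l) (Fin l) (PadicAlgCl p) := Q.map (algebraMap (padicQbar p) (PadicAlgCl p))
    with hQ'
  have hP'u : IsUnit P'.det := (Matrix.isUnit_iff_isUnit_det _).1 (isUnit_map_padicQbar hP)
  have hQ'u : IsUnit Q'.det := (Matrix.isUnit_iff_isUnit_det _).1 (isUnit_map_padicQbar hQ)
  set N : Matrix (Fin d) (Fin l) (PadicAlgCl p) := P' * M * Q' with hN
  have hNrank : N.rank ≤ 1 := by
    rw [hN, Matrix.rank_mul_eq_left_of_isUnit_det _ _ hQ'u,
      Matrix.rank_mul_eq_right_of_isUnit_det _ _ hP'u]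
    exact hrank
  have hzero : N ⟨0, hd⟩ ⟨l', hlt⟩ = 0 := hblock ⟨0, hd⟩ ⟨l', hlt⟩ hd'0 le_rfl
  rcases row_or_col_eq_zero_of_rank_le_one N hNrank _ _ hzero with hrow | hcol
  · -- row `0` of `P M = N Q'⁻¹` vanishes: a relation among the rows of `M`
    have hPM : ∀ j, (P' * M) ⟨0, hd⟩ j = 0 := by
      intro j
      rw [← Matrix.mul_nonsing_inv_cancel_right Q' (P' * M) hQ'u, Matrix.mul_apply]
      exact Finset.sum_eq_zero fun k _ => by rw [← hN, hrow k, zero_mul]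
    have hrel : ∑ k, P ⟨0, hd⟩ k • M k = 0 := by
      funext j
      rw [Finset.sum_apply]
      have := hPM j
      rw [Matrix.mul_apply] at this
      simpa [hP', Matrix.map_apply, Pi.smul_apply, IntermediateField.smul_def, smul_eq_mul]
        using this
    have hProw : ∀ k, P ⟨0, hd⟩ k = 0 := Fintype.linearIndependent_iff.1 hrows _ hrel
    have hdet : P.det = 0 := Matrix.det_eq_zero_of_row_eq_zero ⟨0, hd⟩ hProw
    exact ((Matrix.isUnit_iff_isUnit_det P).1 hP).ne_zero hdet
  · -- column `l'` of `M Q = P'⁻¹ N` vanishes: a relation among the columns of `M`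
    have hMQ : ∀ i, (M * Q') i ⟨l', hlt⟩ = 0 := by
      intro i
      rw [← Matrix.nonsing_inv_mul_cancel_left P' (M * Q') hP'u, ← Matrix.mul_assoc P' M Q',
        ← hN, Matrix.mul_apply]
      exact Finset.sum_eq_zero fun k _ => by rw [hcol k, mul_zero]
    have hrel : ∑ k, Q k ⟨l', hlt⟩ • M.transpose k = 0 := by
      funext i
      rw [Finset.sum_apply]
      have := hMQ i
      rw [Matrix.mul_apply] at this
      simpa [hQ', Matrix.map_apply, Pi.smul_apply, Matrix.transpose_apply,
        IntermediateField.smul_def, smul_eq_mul, mul_comm] using this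
    have hQcol : ∀ k, Q k ⟨l', hlt⟩ = 0 := Fintype.linearIndependent_iff.1 hcols _ hrel
    have hdet : Q.det = 0 := Matrix.det_eq_zero_of_column_eq_zero ⟨l', hlt⟩ hQcol
    exact ((Matrix.isUnit_iff_isUnit_det Q).1 hQ).ne_zero hdet

/-- `θ̃(M) = l/d` for a rank-`≤ 1` matrix with `ℚ̄`-linearly independent rows and columns
(`d > 0`). [cite: Roy1992, §4 proof of Corollary 2 (p. 38)] -/
theorem thetaBar_eq_of_rank_le_one (M : Matrix (Fin d) (Fin l) (PadicAlgCl p)) (hd : 0 < d)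
    (hrank : M.rank ≤ 1)
    (hrows : LinearIndependent (padicQbar p) (fun i => M i))
    (hcols : LinearIndependent (padicQbar p) (fun j => M.transpose j)) :
    thetaBar M = (l : ℝ) / (d : ℝ) :=
  le_antisymm (thetaBar_le M hd) (le_thetaBar_of_rank_le_one M hd hrank hrows hcols)

variable (p) in
/-- **Roy 1992, §4 Corollary 2 for `K = ℚ̄_p` — the `p`-adic strong six exponentials theorem —
PROVED from Corollary 1** (`roy1992_padic_cor1`), following the printed proof: "Let `M` be a
`2 × 3` matrix with coefficients in `𝓛̃`. Assume that its rows are linearly independent over `ℚ̄` and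
that its columns are linearly independent over `ℚ̄`. Then the rank of `M` is `2`. Proof. … for each
matrix `M` of size `d × l` with `d, l > 0`, of rank `1`, whose rows and columns are linearly
independent over `ℚ̄`, we have `θ̃(M) = l/d`. In our situation, if the rank of `M` were `1`, we
would thus have `θ̃(M) = 3/2`, and this would contradict Corollary 1" (`(3/2)·2/(1 + 3/2) = 6/5 > 1`).
[cite: Roy1992, §4 Corollary 2 and its proof (p. 38)] -/
theorem roy1992_padic_strongSixExponentials_of_cor1 (h : roy1992_padic_cor1 p)
    (M : Matrix (Fin 2) (Fin 3) (PadicAlgCl p)) (hM : ∀ i j, M i j ∈ logLinearForms p)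
    (hrows : LinearIndependent (padicQbar p) (fun i => M i))
    (hcols : LinearIndependent (padicQbar p) (fun j => M.transpose j)) : M.rank = 2 := by
  have hle : M.rank ≤ 2 := M.rank_le_height
  by_contra hne
  have hrank : M.rank ≤ 1 := by omega
  have hθ : thetaBar M = (3 : ℝ) / 2 := by
    have := thetaBar_eq_of_rank_le_one M two_pos hrank hrows hcols
    simpa using this
  have hcor := h 2 3 M two_pos three_pos hM
  rw [hθ] at hcor
  have hr : (M.rank : ℝ) ≤ 1 := by exact_mod_cast hrank
  norm_num at hcor
  linarith

end CorTwo

end Literature.NumberTheory.Transcendental
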